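import Summits.FinalStateConjecture.FinalStateConjecture.Theorems.UniformPhotonSphereChannels.Negative.ConformalChainRule

/-!
# Crux `UniformPhotonSphereChannels` (K1), negative side — the Regge–Wheeler energy on a time
# slice read in the horizon frame (dominant energy + change of variables)

Support file of the standing disprover of item stmt-FinalStateConjecture-10045.  In the Rindler
chart `X ± T = κ⁻¹e^{κ(x ± t)}` the tortoise time slice `t = t₁` is the ray `T = βX`,
`β = tanh κt₁` (`t₁ = log((1+β)/(1−β))/2κ`), parametrised by `X` with `dx/dX = 1/(κX)`,
`x = ξ(X) = (log(κX(1+β)) + log(κX(1−β)))/2κ`.  For `u = ψ ∘ S` (conformal composite with the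
logarithm `α = log(κ·)/κ` on the relevant range) the first partials are related by
`ψ_t = κX(u_T + βu_X)`, `ψ_x = κX(u_X + βu_T)`, and pure algebra gives the DOMINANT ENERGY bound
`e_RW(t₁, x) dx ≤ 2κX · (e_T + β·2u_T u_X)(βX, X) dX` (`W = V/(κ²X²(1−β²))`), whence
(`rw_energy_slice_le`)

`∫_{ξX₁}^{ξX₂} e_RW(t₁, ·) ≤ 2κX₂ ∫_{X₁}^{X₂} (e_T + 2β u_T u_X)(βX, X) dX`.

The right-hand side is the `T`-energy flux through the ray, the boundary term of the `WaveDefect`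
identity on the region above the ray. [folklore]
-/

namespace Summit.FinalStateConjecture.FinalStateConjecture.Theorems

open Set Filter Topology MeasureTheory intervalIntegral

noncomputable section

namespace WaveDefect

open WaveEnergy

/-- Pure algebra of the dominant energy condition on the ray. -/
theorem dominant_energy_algebra {a b u V κX β : ℝ} (hβ0 : 0 ≤ β) (hβ1 : β < 1) (hκX : 0 < κX)
    (hV : 0 ≤ V) :
    ((κX * (a + β * b)) ^ 2 + (κX * (b + β * a)) ^ 2 + V * u ^ 2) / κX
      ≤ 2 * κX * (a ^ 2 + b ^ 2 + V / (κX ^ 2 * (1 - β ^ 2)) * u ^ 2 + β * (2 * a * b)) := by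
  have h1b : 0 < 1 - β ^ 2 := by nlinarith
  rw [div_le_iff₀ hκX]
  have hVu : V * u ^ 2 ≤ 2 * (V / (1 - β ^ 2)) * u ^ 2 := by
    have : V ≤ 2 * (V / (1 - β ^ 2)) := by
      rw [mul_div_assoc', le_div_iff₀ h1b]; nlinarith
    exact mul_le_mul_of_nonneg_right this (sq_nonneg _)
  have hkey : (κX * (a + β * b)) ^ 2 + (κX * (b + β * a)) ^ 2
      ≤ 2 * κX ^ 2 * (a ^ 2 + b ^ 2 + β * (2 * a * b)) := by
    nlinarith [sq_nonneg a, sq_nonneg b, sq_nonneg κX,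
      mul_nonneg (mul_nonneg (sq_nonneg κX) h1b.le) (add_nonneg (sq_nonneg a) (sq_nonneg b))]
  have hk2 : 2 * κX * (V / (κX ^ 2 * (1 - β ^ 2)) * u ^ 2) * κX = 2 * (V / (1 - β ^ 2)) * u ^ 2 := by
    have hk : V / (κX ^ 2 * (1 - β ^ 2)) = V / (1 - β ^ 2) / κX ^ 2 := by
      rw [div_div, mul_comm]
    rw [hk, div_mul_eq_mul_div, mul_div_assoc', div_mul_eq_mul_div,
      div_eq_iff (pow_ne_zero 2 hκX.ne')]
    ring
  have hexp : 2 * κX * (a ^ 2 + b ^ 2 + V / (κX ^ 2 * (1 - β ^ 2)) * u ^ 2 + β * (2 * a * b)) * κX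
      = 2 * κX ^ 2 * (a ^ 2 + b ^ 2 + β * (2 * a * b)) + 2 * (V / (1 - β ^ 2)) * u ^ 2 := by
    linear_combination hk2
  rw [hexp]
  linarith

variable {Ψ : ℝ × ℝ → ℝ} {α : ℝ → ℝ} {V : ℝ → ℝ} {κ A₀ β : ℝ}

/-- **The Regge–Wheeler energy of a time slice through the horizon frame.**  Let `Ψ ∈ C²(ℝ²)`
(variables `(t, x)`), `V ≥ 0` continuous, `κ > 0`, `0 ≤ β < 1`, and let `α` agree with
`log(κ·)/κ` together with its derivative `1/(κ·)` on `(A₀, ∞)`, `A₀ ≥ 0`.  With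
`u = Ψ ∘ S` the conformal composite, `ξ(X) = (log(κX(1+β)) + log(κX(1−β)))/2κ`,
`t₁ = log((1+β)/(1−β))/2κ`, and `0 < X₁ ≤ X₂` with `A₀ < X₁(1−β)`:
`∫_{ξ X₁}^{ξ X₂} (Ψ_t² + Ψ_x² + VΨ²)(t₁, ·) ≤ 2κX₂ ∫_{X₁}^{X₂} (u_T² + u_X² + W u² + 2β u_T u_X)(βX, X) dX`,
`W = V(ξX)/(κ²X²(1−β²))`. [folklore] -/
theorem rw_energy_slice_le (hΨ : ContDiff ℝ 2 Ψ) (hVc : Continuous V) (hV0 : ∀ x, 0 ≤ V x)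
    (hκ : 0 < κ) (hβ0 : 0 ≤ β) (hβ1 : β < 1)
    (hα : ContDiff ℝ 2 α) (hαlog : ∀ a, A₀ < a → α a = Real.log (κ * a) / κ)
    (hα' : ∀ a, A₀ < a → deriv α a = 1 / (κ * a))
    {X₁ X₂ : ℝ} (hX : X₁ ≤ X₂) (hX₁pos : 0 < X₁) (hX₁ : A₀ < X₁ * (1 - β)) :
    ∫ x in ((Real.log (κ * (X₁ * (1 + β))) + Real.log (κ * (X₁ * (1 - β)))) / (2 * κ))..
        ((Real.log (κ * (X₂ * (1 + β))) + Real.log (κ * (X₂ * (1 - β)))) / (2 * κ)),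
      ((fderiv ℝ Ψ (Real.log ((1 + β) / (1 - β)) / (2 * κ), x) (1, 0)) ^ 2
        + (fderiv ℝ Ψ (Real.log ((1 + β) / (1 - β)) / (2 * κ), x) (0, 1)) ^ 2
        + V x * Ψ (Real.log ((1 + β) / (1 - β)) / (2 * κ), x) ^ 2)
      ≤ 2 * κ * X₂ * ∫ X in X₁..X₂,
        ((fderiv ℝ (fun z : ℝ × ℝ => Ψ ((α (z.2 + z.1) - α (z.2 - z.1)) / 2,
            (α (z.2 + z.1) + α (z.2 - z.1)) / 2)) (β * X, X) (1, 0)) ^ 2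
          + (fderiv ℝ (fun z : ℝ × ℝ => Ψ ((α (z.2 + z.1) - α (z.2 - z.1)) / 2,
            (α (z.2 + z.1) + α (z.2 - z.1)) / 2)) (β * X, X) (0, 1)) ^ 2
          + V ((Real.log (κ * (X * (1 + β))) + Real.log (κ * (X * (1 - β)))) / (2 * κ))
              / (κ ^ 2 * X ^ 2 * (1 - β ^ 2))
            * Ψ (Real.log ((1 + β) / (1 - β)) / (2 * κ),
                (Real.log (κ * (X * (1 + β))) + Real.log (κ * (X * (1 - β)))) / (2 * κ)) ^ 2
          + β * (2 * fderiv ℝ (fun z : ℝ × ℝ => Ψ ((α (z.2 + z.1) - α (z.2 - z.1)) / 2,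
              (α (z.2 + z.1) + α (z.2 - z.1)) / 2)) (β * X, X) (1, 0)
            * fderiv ℝ (fun z : ℝ × ℝ => Ψ ((α (z.2 + z.1) - α (z.2 - z.1)) / 2,
              (α (z.2 + z.1) + α (z.2 - z.1)) / 2)) (β * X, X) (0, 1))) := by
  have h1b : 0 < 1 - β := by linarith
  have h1b' : 0 < 1 + β := by linarith
  have hβ2 : 0 < 1 - β ^ 2 := by
    rw [show (1 : ℝ) - β ^ 2 = (1 - β) * (1 + β) by ring]; exact mul_pos h1b h1b'
  -- notation
  set t₁ : ℝ := Real.log ((1 + β) / (1 - β)) / (2 * κ) with ht₁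
  set ξ : ℝ → ℝ := fun X => (Real.log (κ * (X * (1 + β))) + Real.log (κ * (X * (1 - β)))) / (2 * κ)
    with hξ
  set u : ℝ × ℝ → ℝ := fun z => Ψ ((α (z.2 + z.1) - α (z.2 - z.1)) / 2,
    (α (z.2 + z.1) + α (z.2 - z.1)) / 2) with hu
  -- facts on the ray for `X ≥ X₁`
  have hray : ∀ X, X₁ ≤ X →
      0 < X ∧ A₀ < X * (1 - β) ∧ A₀ < X * (1 + β) ∧
      X + β * X = X * (1 + β) ∧ X - β * X = X * (1 - β) ∧
      (α (X * (1 + β)) - α (X * (1 - β))) / 2 = t₁ ∧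
      (α (X * (1 + β)) + α (X * (1 - β))) / 2 = ξ X ∧
      (deriv α (X * (1 + β)) + deriv α (X * (1 - β))) / 2 = 1 / (κ * X * (1 - β ^ 2)) ∧
      (deriv α (X * (1 + β)) - deriv α (X * (1 - β))) / 2 = -β / (κ * X * (1 - β ^ 2)) := by
    intro X hXX
    have hXpos : 0 < X := lt_of_lt_of_le hX₁pos hXX
    have hB : A₀ < X * (1 - β) := lt_of_lt_of_le hX₁ (mul_le_mul_of_nonneg_right hXX h1b.le)
    have hA : A₀ < X * (1 + β) :=
      lt_of_lt_of_le hB (mul_le_mul_of_nonneg_left (by linarith) hXpos.le)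
    have hp1 : 0 < κ * (X * (1 + β)) := mul_pos hκ (mul_pos hXpos h1b')
    have hp2 : 0 < κ * (X * (1 - β)) := mul_pos hκ (mul_pos hXpos h1b)
    have hne3 : κ * X * (1 - β ^ 2) ≠ 0 := mul_ne_zero (mul_ne_zero hκ.ne' hXpos.ne') hβ2.ne'
    refine ⟨hXpos, hB, hA, by ring, by ring, ?_, ?_, ?_, ?_⟩
    · rw [hαlog _ hA, hαlog _ hB]
      have hq : (1 + β) / (1 - β) = κ * (X * (1 + β)) / (κ * (X * (1 - β))) := by
        rw [div_eq_div_iff h1b.ne' hp2.ne']; ring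
      show _ = Real.log ((1 + β) / (1 - β)) / (2 * κ)
      rw [hq, Real.log_div hp1.ne' hp2.ne']
      ring
    · rw [hαlog _ hA, hαlog _ hB]
      show _ = (Real.log (κ * (X * (1 + β))) + Real.log (κ * (X * (1 - β)))) / (2 * κ)
      ring
    · rw [hα' _ hA, hα' _ hB]
      have k1 : 1 / (κ * (X * (1 + β))) = (1 - β) / (κ * X * (1 - β ^ 2)) := by
        rw [div_eq_div_iff hp1.ne' hne3]; ring
      have k2 : 1 / (κ * (X * (1 - β))) = (1 + β) / (κ * X * (1 - β ^ 2)) := by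
        rw [div_eq_div_iff hp2.ne' hne3]; ring
      rw [k1, k2]; ring
    · rw [hα' _ hA, hα' _ hB]
      have k1 : 1 / (κ * (X * (1 + β))) = (1 - β) / (κ * X * (1 - β ^ 2)) := by
        rw [div_eq_div_iff hp1.ne' hne3]; ring
      have k2 : 1 / (κ * (X * (1 - β))) = (1 + β) / (κ * X * (1 - β ^ 2)) := by
        rw [div_eq_div_iff hp2.ne' hne3]; ring
      rw [k1, k2]; ring
  -- the substitution `x = ξ(X)`, `ξ' = 1/(κX)`
  have hξd : ∀ X, 0 < X → HasDerivAt ξ (1 / (κ * X)) X := by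
    intro X hXpos
    have hne1 : κ * (X * (1 + β)) ≠ 0 := (mul_pos hκ (mul_pos hXpos h1b')).ne'
    have hne2 : κ * (X * (1 - β)) ≠ 0 := (mul_pos hκ (mul_pos hXpos h1b)).ne'
    have h1 : HasDerivAt (fun X => Real.log (κ * (X * (1 + β))))
        (κ * (1 * (1 + β)) / (κ * (X * (1 + β)))) X :=
      (((hasDerivAt_id X).mul_const (1 + β)).const_mul κ).log hne1
    have h2 : HasDerivAt (fun X => Real.log (κ * (X * (1 - β))))
        (κ * (1 * (1 - β)) / (κ * (X * (1 - β)))) X :=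
      (((hasDerivAt_id X).mul_const (1 - β)).const_mul κ).log hne2
    have h := (h1.add h2).div_const (2 * κ)
    refine h.congr_deriv ?_
    have e1 : κ * (1 * (1 + β)) / (κ * (X * (1 + β))) = 1 / X := by
      rw [div_eq_div_iff hne1 hXpos.ne']; ring
    have e2 : κ * (1 * (1 - β)) / (κ * (X * (1 - β))) = 1 / X := by
      rw [div_eq_div_iff hne2 hXpos.ne']; ring
    rw [e1, e2, ← two_mul, mul_one_div, div_div,
      div_eq_div_iff (mul_ne_zero hXpos.ne' (mul_ne_zero two_ne_zero hκ.ne'))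
        (mul_ne_zero hκ.ne' hXpos.ne')]
    ring
  -- the integrand on the tortoise line
  set eRW : ℝ → ℝ := fun x => (fderiv ℝ Ψ (t₁, x) (1, 0)) ^ 2 + (fderiv ℝ Ψ (t₁, x) (0, 1)) ^ 2
      + V x * Ψ (t₁, x) ^ 2 with heRW
  have heRWc : Continuous eRW := by
    have hd := continuous_fderiv_apply hΨ (1, 0)
    have hd' := continuous_fderiv_apply hΨ (0, 1)
    have hc : Continuous fun x : ℝ => (t₁, x) := Continuous.prodMk_right t₁
    simp only [heRW]
    exact (((hd.comp hc).pow 2).add ((hd'.comp hc).pow 2)).add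
      (hVc.mul ((hΨ.continuous.comp hc).pow 2))
  have hξc : ContinuousOn ξ (Icc X₁ X₂) := by
    show ContinuousOn (fun X => (Real.log (κ * (X * (1 + β))) + Real.log (κ * (X * (1 - β))))
      / (2 * κ)) (Icc X₁ X₂)
    refine ContinuousOn.div_const (ContinuousOn.add ?_ ?_) _
    · exact ContinuousOn.log (by fun_prop) fun X hXX =>
        (mul_pos hκ (mul_pos (lt_of_lt_of_le hX₁pos hXX.1) h1b')).ne'
    · exact ContinuousOn.log (by fun_prop) fun X hXX =>
        (mul_pos hκ (mul_pos (lt_of_lt_of_le hX₁pos hXX.1) h1b)).ne'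
  have hsubst : ∫ x in ξ X₁..ξ X₂, eRW x = ∫ X in X₁..X₂, eRW (ξ X) * (1 / (κ * X)) := by
    have h := intervalIntegral.integral_comp_mul_deriv' (a := X₁) (b := X₂) (f := ξ)
      (f' := fun X => 1 / (κ * X)) (g := eRW) ?_ ?_ heRWc.continuousOn
    · exact h.symm
    · intro X hXX; rw [uIcc_of_le hX] at hXX; exact hξd X (lt_of_lt_of_le hX₁pos hXX.1)
    · refine ContinuousOn.div continuousOn_const (continuousOn_const.mul continuousOn_id) ?_
      intro X hXX; rw [uIcc_of_le hX] at hXX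
      exact (mul_pos hκ (lt_of_lt_of_le hX₁pos hXX.1)).ne'
  -- pointwise dominant energy on `[X₁, X₂]`
  have hpt : ∀ X ∈ Icc X₁ X₂, eRW (ξ X) * (1 / (κ * X)) ≤ 2 * κ * X₂ *
      ((fderiv ℝ u (β * X, X) (1, 0)) ^ 2 + (fderiv ℝ u (β * X, X) (0, 1)) ^ 2
        + V (ξ X) / (κ ^ 2 * X ^ 2 * (1 - β ^ 2)) * Ψ (t₁, ξ X) ^ 2
        + β * (2 * fderiv ℝ u (β * X, X) (1, 0) * fderiv ℝ u (β * X, X) (0, 1))) := by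
    intro X hXX
    obtain ⟨hXpos, hB, hA, hApB, hAmB, htt, hxx, hσ, hδ⟩ := hray X hXX.1
    have hκX : 0 < κ * X := mul_pos hκ hXpos
    have hcne : κ * X * (1 - β ^ 2) ≠ 0 := mul_ne_zero hκX.ne' hβ2.ne'
    -- the first partials of `u` on the ray
    obtain ⟨hT, hXd⟩ := fderiv_conformal hΨ hα hα (β * X) X
    rw [hApB, hAmB, htt, hxx, hσ, hδ] at hT hXd
    have hufun : (fun z : ℝ × ℝ => Ψ ((α (z.2 + z.1) - α (z.2 - z.1)) / 2,
        (α (z.2 + z.1) + α (z.2 - z.1)) / 2)) = u := rfl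
    rw [hufun] at hT hXd
    -- linearity: `DΨ(p)(σ, δ) = σ Ψ_t + δ Ψ_x`
    have e1 : ((1 / (κ * X * (1 - β ^ 2)) : ℝ), (-β / (κ * X * (1 - β ^ 2)) : ℝ))
        = (1 / (κ * X * (1 - β ^ 2))) • ((1 : ℝ), (0 : ℝ))
          + (-β / (κ * X * (1 - β ^ 2))) • ((0 : ℝ), (1 : ℝ)) := by
      ext <;> simp
    have e2 : ((-β / (κ * X * (1 - β ^ 2)) : ℝ), (1 / (κ * X * (1 - β ^ 2)) : ℝ))
        = (-β / (κ * X * (1 - β ^ 2))) • ((1 : ℝ), (0 : ℝ))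
          + (1 / (κ * X * (1 - β ^ 2))) • ((0 : ℝ), (1 : ℝ)) := by
      ext <;> simp
    rw [e1, map_add, map_smul, map_smul, smul_eq_mul, smul_eq_mul] at hT
    rw [e2, map_add, map_smul, map_smul, smul_eq_mul, smul_eq_mul] at hXd
    set pt := fderiv ℝ Ψ (t₁, ξ X) (1, 0) with hpt'
    set px := fderiv ℝ Ψ (t₁, ξ X) (0, 1) with hpx'
    set a := fderiv ℝ u (β * X, X) (1, 0) with ha
    set b := fderiv ℝ u (β * X, X) (0, 1) with hb
    -- invert: `pt = κX(a + βb)`, `px = κX(b + βa)`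
    have h1 : a * (κ * X * (1 - β ^ 2)) = pt - β * px := by
      rw [← eq_div_iff hcne, hT]; ring
    have h2 : b * (κ * X * (1 - β ^ 2)) = px - β * pt := by
      rw [← eq_div_iff hcne, hXd]; ring
    have hpt_eq : pt = κ * X * (a + β * b) := by
      apply mul_right_cancel₀ hβ2.ne'
      linear_combination -h1 - β * h2
    have hpx_eq : px = κ * X * (b + β * a) := by
      apply mul_right_cancel₀ hβ2.ne'
      linear_combination -h2 - β * h1
    have halg := dominant_energy_algebra (a := a) (b := b) (u := Ψ (t₁, ξ X)) (V := V (ξ X))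
      hβ0 hβ1 hκX (hV0 _)
    have hlhs : eRW (ξ X) * (1 / (κ * X))
        = ((κ * X * (a + β * b)) ^ 2 + (κ * X * (b + β * a)) ^ 2
            + V (ξ X) * Ψ (t₁, ξ X) ^ 2) / (κ * X) := by
      simp only [heRW]; rw [← hpt', ← hpx', hpt_eq, hpx_eq]; ring
    rw [hlhs]
    have hf0 : 0 ≤ a ^ 2 + b ^ 2 + V (ξ X) / ((κ * X) ^ 2 * (1 - β ^ 2)) * Ψ (t₁, ξ X) ^ 2
        + β * (2 * a * b) := by
      have hw : 0 ≤ V (ξ X) / ((κ * X) ^ 2 * (1 - β ^ 2)) * Ψ (t₁, ξ X) ^ 2 :=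
        mul_nonneg (div_nonneg (hV0 _) (mul_nonneg (sq_nonneg _) hβ2.le)) (sq_nonneg _)
      have hid : a ^ 2 + b ^ 2 + β * (2 * a * b) = (1 - β) * (a ^ 2 + b ^ 2) + β * (a + b) ^ 2 := by
        ring
      have h3 : 0 ≤ (1 - β) * (a ^ 2 + b ^ 2) + β * (a + b) ^ 2 :=
        add_nonneg (mul_nonneg h1b.le (add_nonneg (sq_nonneg a) (sq_nonneg b)))
          (mul_nonneg hβ0 (sq_nonneg _))
      linarith
    have hmono : 2 * (κ * X) * (a ^ 2 + b ^ 2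
          + V (ξ X) / ((κ * X) ^ 2 * (1 - β ^ 2)) * Ψ (t₁, ξ X) ^ 2 + β * (2 * a * b))
        ≤ 2 * κ * X₂ * (a ^ 2 + b ^ 2
          + V (ξ X) / ((κ * X) ^ 2 * (1 - β ^ 2)) * Ψ (t₁, ξ X) ^ 2 + β * (2 * a * b)) := by
      have h4 := mul_le_mul_of_nonneg_left hXX.2 hκ.le
      have : 2 * (κ * X) ≤ 2 * κ * X₂ := by linarith
      exact mul_le_mul_of_nonneg_right this hf0
    have hrw : κ ^ 2 * X ^ 2 * (1 - β ^ 2) = (κ * X) ^ 2 * (1 - β ^ 2) := by ring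
    rw [hrw]
    exact halg.trans hmono
  -- integrate
  have hu2 : ContDiff ℝ 2 u := contDiff_conformal (n := 2) hΨ hα hα
  have hcont1 : ContinuousOn (fun X => eRW (ξ X) * (1 / (κ * X))) (Icc X₁ X₂) :=
    (heRWc.comp_continuousOn hξc).mul (ContinuousOn.div continuousOn_const (by fun_prop)
      fun X hXX => (mul_pos hκ (lt_of_lt_of_le hX₁pos hXX.1)).ne')
  have hcont2 : ContinuousOn (fun X => 2 * κ * X₂ *
      ((fderiv ℝ u (β * X, X) (1, 0)) ^ 2 + (fderiv ℝ u (β * X, X) (0, 1)) ^ 2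
        + V (ξ X) / (κ ^ 2 * X ^ 2 * (1 - β ^ 2)) * Ψ (t₁, ξ X) ^ 2
        + β * (2 * fderiv ℝ u (β * X, X) (1, 0) * fderiv ℝ u (β * X, X) (0, 1))))
      (Icc X₁ X₂) := by
    have hd := continuous_fderiv_apply hu2 (1, 0)
    have hd' := continuous_fderiv_apply hu2 (0, 1)
    have hray_c : Continuous fun X : ℝ => (β * X, X) :=
      (continuous_const.mul continuous_id).prodMk continuous_id
    have ha : Continuous fun X => fderiv ℝ u (β * X, X) (1, 0) := hd.comp hray_c
    have hb : Continuous fun X => fderiv ℝ u (β * X, X) (0, 1) := hd'.comp hray_c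
    have hΨc : ContinuousOn (fun X => Ψ (t₁, ξ X)) (Icc X₁ X₂) :=
      hΨ.continuous.comp_continuousOn (continuousOn_const.prodMk hξc)
    have hWc : ContinuousOn (fun X => V (ξ X) / (κ ^ 2 * X ^ 2 * (1 - β ^ 2))) (Icc X₁ X₂) := by
      refine ContinuousOn.div (hVc.comp_continuousOn hξc) (by fun_prop) fun X hXX => ?_
      have hXpos := lt_of_lt_of_le hX₁pos hXX.1
      exact mul_ne_zero (mul_ne_zero (pow_ne_zero 2 hκ.ne') (pow_ne_zero 2 hXpos.ne')) hβ2.ne'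
    exact continuousOn_const.mul ((((ha.pow 2).add (hb.pow 2)).continuousOn.add
      (hWc.mul (hΨc.pow 2))).add
        ((continuous_const.mul ((continuous_const.mul ha).mul hb)).continuousOn))
  have hsub : uIcc X₁ X₂ ⊆ Icc X₁ X₂ := (uIcc_of_le hX).subset
  have hmono := intervalIntegral.integral_mono_on hX
    ((hcont1.mono hsub).intervalIntegrable (μ := volume))
    ((hcont2.mono hsub).intervalIntegrable (μ := volume)) hpt
  rw [intervalIntegral.integral_const_mul] at hmono
  exact hsubst.trans_le hmono

end WaveDefect

end

end Summit.FinalStateConjecture.FinalStateConjecture.Theorems
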